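import Summits.AtomisticToContinuum.Crystallization.Theorems.DisclinationRationAlphabetGoodHullElementReduction
import Summits.AtomisticToContinuum.Crystallization.Theorems.HullExactificationCascadeZeroDefectDensityReduction75
import HarnessLib

/-!
# Crux `AlphabetGoodHullElement` (route `DisclinationRation`, stmt-AtomisticToContinuum-15798), line `birth`:
# the crux reduces to ONE energetic input — soft kissing order at `(1/4000, 7/5)`

`alphabetGoodHullElement_of_softKissingOrder75`:

  soft kissing order a.e. in Lennard-Jones ground states (tolerance `1/4000`, two shells deep, gap `7/5`;
  = VERBATIM the registered stub `stub_softKissingOrder` of the sibling crux `ZeroDefectDensity`,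
  `Cruxes/ZeroDefectDensity/Lines/birth.lean`, ENERGETIC, open-problem-sized)
  ⟹ `Summit.AtomisticToContinuum.Crystallization.Theses.DisclinationRation.AlphabetGoodHullElement`.

Composition of two landed theorems: the sibling line's c5 reduction
`ZeroDefectDensityBirth.zeroDefectDensity_of_softKissingOrder75` (the effective local Hales kernel
`localHalesKernel75` at `(1/4000, 7/5)` is a theorem of the tree, p168863/p168956) and
`AlphabetGoodHullElementBirth.alphabetGoodHullElement_of_zeroDefectDensity` (K1 ⇐ stmt-12086 through the
proved exactification `hullGoodEverywhere_proof`, p167055).  Compared with the earlier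
`alphabetGoodHullElement_of_softKissingOrder_of_localHalesKernel` the hypothesis
`BrittleRungDescent.LocalHalesKernel` (stmt-9208, open) is GONE and the gap is `7/5` instead of `131/100`.
So, as of this file, crux 15798 is closed modulo exactly the ONE open energetic input of crux 12086; the
line `birth` asks instead for the weaker-tolerance energetic input `stub_softAlphabetOrder` (`1/100`,
decahedral-axis shells and their elastic far field tolerated) at the price of the unproved kernel
`stub_alphabetKernel`. [folklore]
-/

noncomputable section

namespace Summit.AtomisticToContinuum.Crystallization.Theorems.AlphabetGoodHullElementBirth

open Summit.AtomisticToContinuum.Crystallization.Theses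

/-- **The crux from ONE energetic input.** Soft kissing order almost everywhere along Lennard-Jones
ground states (tolerance `1/4000`, two shells deep, gap `7/5` — verbatim the registered energetic stub of
`Cruxes/ZeroDefectDensity/Lines/birth.lean`) implies `AlphabetGoodHullElement` (stmt-15798): compose the
landed `ZeroDefectDensityBirth.zeroDefectDensity_of_softKissingOrder75` (kernel `localHalesKernel75` is
proved) with the landed `alphabetGoodHullElement_of_zeroDefectDensity`. [folklore] -/
theorem alphabetGoodHullElement_of_softKissingOrder75 : (∀ (x : (N : ℕ) → (Fin N → EuclideanSpace ℝ (Fin 3))), (∀ N, Literature.MathematicalPhysics.StatisticalMechanics.IsGroundState Literature.MathematicalPhysics.StatisticalMechanics.lennardJones (x N)) → Filter.Tendsto (fun N : ℕ => (Nat.card {i : Fin N // ¬ (∃ a : ℝ, 0 < a ∧ ∀ v ∈ Set.range (x N), dist (x N i) v ≤ 13 / 5 * a → ((∀ w ∈ Set.range (x N), w ≠ v → (1 - 1 / 4000) * a ≤ dist v w ∧ (dist v w ≤ (1 + 1 / 4000) * a ∨ 7 / 5 * a ≤ dist v w)) ∧ {w ∈ Set.range (x N) | w ≠ v ∧ dist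 v w ≤ (1 + 1 / 4000) * a}.ncard = 12))} : ℝ) / (N : ℝ)) Filter.atTop (nhds (0 : ℝ))) → Summit.AtomisticToContinuum.Crystallization.Theses.DisclinationRation.AlphabetGoodHullElement :=
  fun hSKO => alphabetGoodHullElement_of_zeroDefectDensity
    (ZeroDefectDensityBirth.zeroDefectDensity_of_softKissingOrder75 hSKO)

end Summit.AtomisticToContinuum.Crystallization.Theorems.AlphabetGoodHullElementBirth

end
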